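import Summits.CriticalPhenomena.PercolationContinuityZ3.Theorems.PercNearOneGluingNoHeavyLowerTailSahiCombDomination
import Summits.CriticalPhenomena.PercolationContinuityZ3.Theorems.PercNearOneGluingNoHeavyLowerTailSahiC3CombCube
import Literature.Combinatorics.Sahi2008.PushForward

/-!
# `NoHeavyLowerTail` (crux stmt-CriticalPhenomena-4575), Sahi's `C₃` at the comb level: SUB-CUBE TRANSPORT —
# events determined by a coordinate set `W` are pull-backs from the cube `↥W`, and (M⁺-3) pulls back with them

Support file (cell `prim-l12`, seat P3, gen 2; `--supports stmt-CriticalPhenomena-4575`).  No `sorry`, no named facts, standard axioms.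
First half of the junta-intersection theorem (`…SahiCombJunta`).

* `restr W ω` (restriction `Set ι → Set ↥W`), `traceFam W X` (the trace family on the sub-cube);
* `bernoulliWeight_freeze_eq`, **`ex_comp_restr`** — MARGINAL OF THE PRODUCT WEIGHT: `E_p[h ∘ restr] = E_{p|_W}[h]` (via freezing the
  coordinates off `W`, `…ex_bernoulliWeight_freeze`); `pushWeight_bernoulliWeight_restr` (the push-forward along restriction is the product
  weight of the sub-cube); **`sahiE_comp_restr`** (`E_k` is invariant, by `sahiE_pushWeight`);
* **`CombPos.comp_restr`** — comb certificates on `↥W` pull back to `ι` (multidegree `c` on `W`, `0` off `W`);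
* `CubeCombPos3 W` — "(M⁺-3) for all triples of increasing events of the cube `↥W`" (a predicate; discharged for `|W| ≤ 3` by the kernel
  certificate `…SahiC3CombCube`, `cubeCombPos3_of_card_le_three`);
* **`combPos_sahiE_three_of_determinedBy_all`** — `CubeCombPos3 W` ⟹ (M⁺-3) for every triple of increasing `W`-determined events of `ι`.
-/

noncomputable section

open scoped Classical

namespace Summit.CriticalPhenomena.PercolationContinuityZ3.Theorems

namespace SahiCombJunta

open Finset Function
open Literature.Combinatorics.Sahi2008
open Literature.Probability.Percolation (DeterminedBy determinedBy_iff)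
open Literature.Probability.Percolation.DecisionTree (ind ind_of_mem ind_of_not_mem ind_nonneg)
open Literature.Probability.Percolation.BHK2006 (weight)
open SahiComb

variable {ι : Type} [Fintype ι]

/-! ### Restriction to a sub-cube -/

section Restrict

variable (W : Set ι)

omit [Fintype ι] in
/-- Restriction of a configuration to the coordinates in `W`. [this work] -/
def restr (ω : Set ι) : Set ↥W := {x | x.1 ∈ ω}

omit [Fintype ι] in
/-- Membership in a restriction. [this work] -/
@[simp] theorem mem_restr (ω : Set ι) (x : ↥W) : x ∈ restr W ω ↔ x.1 ∈ ω := Iff.rfl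

omit [Fintype ι] in
/-- Restriction ignores the coordinates outside `W`. [this work] -/
theorem restr_union_compl (ω : Set ι) : restr W (ω ∪ Wᶜ) = restr W ω := by
  ext x
  simp only [mem_restr, Set.mem_union, Set.mem_compl_iff]
  exact ⟨fun h => h.elim id fun h' => absurd x.2 h', fun h => Or.inl h⟩

omit [Fintype ι] in
/-- The image of a restriction is the trace on `W`. [this work] -/
theorem image_restr (ω : Set ι) : Subtype.val '' restr W ω = ω ∩ W := by
  ext e
  simp only [Set.mem_image, mem_restr, Set.mem_inter_iff]
  constructor
  · rintro ⟨x, hx, rfl⟩; exact ⟨hx, x.2⟩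
  · rintro ⟨he, heW⟩; exact ⟨⟨e, heW⟩, he, rfl⟩

omit [Fintype ι] in
/-- Restricting a lifted configuration. [this work] -/
theorem restr_image_union_compl (η : Set ↥W) : restr W (Subtype.val '' η ∪ Wᶜ) = η := by
  ext x
  simp only [mem_restr, Set.mem_union, Set.mem_image, Set.mem_compl_iff]
  constructor
  · rintro (⟨y, hy, hyx⟩ | h)
    · rwa [← Subtype.ext hyx]
    · exact absurd x.2 h
  · intro hx; exact Or.inl ⟨x, hx, rfl⟩

/-- The product weight frozen to `1` on `S = Wᶜ` is the product weight of the sub-cube on configurations containing `S`, and `0`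
elsewhere (stated with a variable `S` so that the frozen parameter matches `ex_bernoulliWeight_freeze` syntactically). [this work] -/
theorem bernoulliWeight_freeze_eq (S : Set ι) (hS : S = Wᶜ) (p : ι → unitInterval) (ω : Set ι) :
    bernoulliWeight (fun e => if e ∈ S then (1 : unitInterval) else p e) ω =
      if S ⊆ ω then bernoulliWeight (p ∘ Subtype.val) (restr W ω) else 0 := by
  have hSW : ∀ e, e ∈ S ↔ e ∉ W := fun e => by rw [hS]; rfl
  have step1 : bernoulliWeight (fun e => if e ∈ S then (1 : unitInterval) else p e) ω =
      ∏ e, (if e ∈ W then (if e ∈ ω then (p e : ℝ) else 1 - (p e : ℝ)) else (if e ∈ ω then (1 : ℝ) else 0)) := by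
    simp only [bernoulliWeight, weight]
    exact Fintype.prod_congr _ _ fun e => by
      by_cases heW : e ∈ W <;> by_cases heo : e ∈ ω <;> simp [heW, heo, hSW]
  have step2 : bernoulliWeight (p ∘ Subtype.val) (restr W ω) =
      ∏ x : ↥W, (if x.1 ∈ ω then (p x.1 : ℝ) else 1 - (p x.1 : ℝ)) := by
    simp only [bernoulliWeight, weight, mem_restr, Function.comp]
  rw [step1, step2, ← Fintype.prod_subtype_mul_prod_subtype (fun e => e ∈ W)]
  have hA : (∏ x : {e // e ∈ W}, (if x.1 ∈ W then (if x.1 ∈ ω then (p x.1 : ℝ) else 1 - (p x.1 : ℝ))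
      else (if x.1 ∈ ω then (1 : ℝ) else 0))) = ∏ x : {e // e ∈ W}, (if x.1 ∈ ω then (p x.1 : ℝ) else 1 - (p x.1 : ℝ)) :=
    Fintype.prod_congr _ _ fun x => by simp only [x.2, if_true]
  have hB : (∏ x : {e // ¬ e ∈ W}, (if x.1 ∈ W then (if x.1 ∈ ω then (p x.1 : ℝ) else 1 - (p x.1 : ℝ))
      else (if x.1 ∈ ω then (1 : ℝ) else 0))) = if S ⊆ ω then 1 else 0 := by
    rw [Fintype.prod_congr _ (fun x : {e // ¬ e ∈ W} => if x.1 ∈ ω then (1 : ℝ) else 0) fun x => by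
      simp only [x.2, if_false]]
    rw [Fintype.prod_boole]
    by_cases hsub : S ⊆ ω
    · have h' : ∀ x : {e // e ∉ W}, (x.1 ∈ ω) := fun x => hsub ((hSW x.1).2 x.2)
      rw [if_pos hsub, if_pos h']
    · have h' : ¬ ∀ x : {e // e ∉ W}, (x.1 ∈ ω) := fun h => hsub fun e he => h ⟨e, (hSW e).1 he⟩
      rw [if_neg hsub, if_neg h']
  rw [hA, hB]
  split_ifs <;> simp

/-- **Marginal of the product weight**: `E_p[h ∘ restr] = E_{p|_W}[h]` for every `h` on the sub-cube. [this work] -/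
theorem ex_comp_restr (p : ι → unitInterval) (h : Set ↥W → ℝ) :
    ex (bernoulliWeight p) (h ∘ restr W) = ex (bernoulliWeight (p ∘ Subtype.val)) h := by
  have h1 := ex_bernoulliWeight_freeze p Wᶜ (h ∘ restr W)
  have h2 : (fun ω => (h ∘ restr W) (ω ∪ Wᶜ)) = h ∘ restr W := by
    funext ω; simp only [Function.comp, restr_union_compl]
  rw [h2] at h1
  rw [← h1, ex_def, ex_def]
  simp only [bernoulliWeight_freeze_eq W Wᶜ rfl, ite_mul, zero_mul]
  rw [← sum_filter]
  refine sum_nbij' (restr W) (fun η => Subtype.val '' η ∪ Wᶜ) (fun ω _ => mem_univ _) (fun η _ => ?_) (fun ω hω => ?_)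
    (fun η _ => restr_image_union_compl W η) (fun ω _ => rfl)
  · exact mem_filter.2 ⟨mem_univ _, Set.subset_union_right⟩
  · have hsub : Wᶜ ⊆ ω := (mem_filter.1 hω).2
    rw [image_restr]
    ext e
    simp only [Set.mem_union, Set.mem_inter_iff, Set.mem_compl_iff]
    constructor
    · rintro (⟨he, -⟩ | he)
      · exact he
      · exact hsub he
    · intro he
      by_cases heW : e ∈ W
      · exact Or.inl ⟨he, heW⟩
      · exact Or.inr heW

/-- The push-forward of the product weight along restriction is the product weight of the sub-cube. [this work] -/
theorem pushWeight_bernoulliWeight_restr (p : ι → unitInterval) :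
    pushWeight (bernoulliWeight p) (restr W) = bernoulliWeight (p ∘ Subtype.val) := by
  funext η
  rw [pushWeight_eq_ex]
  have h := ex_comp_restr W p (fun η' => if η' = η then 1 else 0)
  have hL : (fun ω => if restr W ω = η then bernoulliWeight p ω else 0) =
      fun ω => bernoulliWeight p ω * ((fun η' => if η' = η then (1 : ℝ) else 0) ∘ restr W) ω := by
    funext ω; simp only [Function.comp]; split_ifs <;> simp
  rw [show ex (bernoulliWeight p) (fun ω => if restr W ω = η then 1 else 0) =
      ex (bernoulliWeight p) ((fun η' => if η' = η then (1 : ℝ) else 0) ∘ restr W) from rfl, h, ex_def]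
  rw [Finset.sum_eq_single η]
  · simp
  · intro η' _ hne; simp [hne]
  · intro hη; exact absurd (mem_univ η) hη

/-- **`E_k` under the product weight is invariant under pulling events back from a sub-cube.** [this work] -/
theorem sahiE_comp_restr (p : ι → unitInterval) (k : ℕ) (f : Fin k → Set ↥W → ℝ) :
    sahiE (bernoulliWeight p) k (fun i => f i ∘ restr W) = sahiE (bernoulliWeight (p ∘ Subtype.val)) k f := by
  rw [← pushWeight_bernoulliWeight_restr W p, sahiE_pushWeight]

/-- **Comb certificates pull back from a sub-cube**: a certificate of multidegree `c` on `↥W` gives one of multidegree "`c` on `W`, `0` off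
`W`" for the pulled-back function. [this work] -/
theorem CombPos.comp_restr {c : ↥W → ℕ} {G : (↥W → unitInterval) → ℝ} (h : CombPos c G) :
    CombPos (fun e => if he : e ∈ W then c ⟨e, he⟩ else 0) (fun p : ι → unitInterval => G (p ∘ Subtype.val)) := by
  obtain ⟨N, hN, hG⟩ := h
  refine ⟨fun j' => N (j' ∘ Subtype.val), fun j' => hN _, fun p => ?_⟩
  change G (p ∘ Subtype.val) = _
  rw [hG]
  refine sum_nbij' (fun j e => if he : e ∈ W then j ⟨e, he⟩ else 0) (fun j' => j' ∘ Subtype.val) (fun j hj => ?_)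
    (fun j' hj' => ?_) (fun j _ => ?_) (fun j' hj' => ?_) (fun j hj => ?_)
  · rw [mem_box] at hj ⊢
    intro e
    by_cases he : e ∈ W
    · simp only [he, dif_pos]; exact hj ⟨e, he⟩
    · simp only [he, dif_neg, not_false_eq_true, le_refl]
  · rw [mem_box] at hj' ⊢
    intro x
    have := hj' x.1
    simp only [x.2, dif_pos] at this
    exact this
  · funext x; simp only [Function.comp, x.2, dif_pos]
  · funext e
    by_cases he : e ∈ W
    · simp only [he, dif_pos, Function.comp]
    · simp only [he, dif_neg, not_false_eq_true]
      have := mem_box.1 hj' e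
      simp only [he, dif_neg, not_false_eq_true, nonpos_iff_eq_zero] at this
      exact this.symm
  · -- the basis functions agree
    have hj' : (fun j' => N (j' ∘ Subtype.val)) (fun e => if he : e ∈ W then j ⟨e, he⟩ else 0) = N j := by
      simp only
      congr 1
      funext x; simp only [Function.comp, x.2, dif_pos]
    rw [hj']
    congr 1
    unfold bern
    rw [← Fintype.prod_subtype_mul_prod_subtype (fun e => e ∈ W)]
    have h2 : (∏ x : {e // ¬ e ∈ W}, ((p x.1 : ℝ) ^ ((fun e => if he : e ∈ W then j ⟨e, he⟩ else 0) x.1) *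
        (1 - (p x.1 : ℝ)) ^ ((fun e => if he : e ∈ W then c ⟨e, he⟩ else 0) x.1 -
          (fun e => if he : e ∈ W then j ⟨e, he⟩ else 0) x.1))) = 1 :=
      Finset.prod_eq_one fun x _ => by simp only [x.2, dif_neg, not_false_eq_true, pow_zero, Nat.sub_zero, mul_one]
    rw [h2, mul_one]
    refine Fintype.prod_congr _ _ fun x => ?_
    simp only [x.2, dif_pos, Function.comp]

end Restrict

/-! ### Events determined by `W` are pull-backs from the sub-cube `↥W` -/

section Determined

variable (W : Set ι)

omit [Fintype ι] in
/-- The trace family on the sub-cube. [this work] -/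
def traceFam (X : Set (Set ι)) : Set (Set ↥W) := {η | Subtype.val '' η ∈ X}

omit [Fintype ι] in
/-- A `W`-determined event is the pull-back of its trace family. [this work] -/
theorem ind_eq_comp_restr_of_determinedBy {X : Set (Set ι)} (hX : DeterminedBy X W) : ind X = ind (traceFam W X) ∘ restr W := by
  funext ω
  have key : ω ∈ X ↔ restr W ω ∈ traceFam W X := by
    simp only [traceFam, Set.mem_setOf_eq, image_restr]
    exact (determinedBy_iff X W).1 hX ω (ω ∩ W) (by rw [Set.inter_assoc, Set.inter_self])
  simp only [Function.comp]
  by_cases hω : ω ∈ X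
  · rw [ind_of_mem hω, ind_of_mem (key.1 hω)]
  · rw [ind_of_not_mem hω, ind_of_not_mem fun h => hω (key.2 h)]

omit [Fintype ι] in
/-- Traces of increasing events are increasing. [this work] -/
theorem isUpperSet_traceFam {X : Set (Set ι)} (hX : IsUpperSet X) : IsUpperSet (traceFam W X) :=
  fun _ _ hle hη => hX (Set.image_mono hle) hη

/-- **(M⁺-3) on the cube `↥W`**: comb positivity of `E₃` for all triples of increasing events of `2^W` (stated once, so that every user
sees the same `Fintype ↥W` instance). [this work] -/
def CubeCombPos3 : Prop :=
  ∀ X Y Z : Set (Set ↥W), IsUpperSet X → IsUpperSet Y → IsUpperSet Z →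
    CombPos (fun _ : ↥W => 3) (fun q => sahiE (bernoulliWeight q) 3 ![ind X, ind Y, ind Z])

/-- The kernel certificate discharges `CubeCombPos3 W` for `|W| ≤ 3` (`…SahiC3CombCube`). [this work] -/
theorem cubeCombPos3_of_card_le_three (hW : Fintype.card ↥W ≤ 3) : CubeCombPos3 W :=
  fun _ _ _ hX hY hZ => SahiC3CombCube.combPos_sahiE_three_of_card_le_three hW hX hY hZ

/-- **Sub-cube transport of (M⁺-3).**  If (M⁺-3) holds for all triples of increasing events of the cube `↥W`, then it holds for every
triple of increasing `W`-determined events of `ι`. [this work] -/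
theorem combPos_sahiE_three_of_determinedBy_all (hbase : CubeCombPos3 W) {X Y Z : Set (Set ι)} (hX : IsUpperSet X)
    (hY : IsUpperSet Y) (hZ : IsUpperSet Z) (hXd : DeterminedBy X W) (hYd : DeterminedBy Y W) (hZd : DeterminedBy Z W) :
    CombPos (fun _ : ι => 3) (fun p => sahiE (bernoulliWeight p) 3 ![ind X, ind Y, ind Z]) := by
  have h := CombPos.comp_restr W (hbase _ _ _ (isUpperSet_traceFam W hX) (isUpperSet_traceFam W hY) (isUpperSet_traceFam W hZ))
  refine (h.mono fun e => ?_).congr fun p => ?_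
  · by_cases he : e ∈ W <;> simp [he]
  · rw [← sahiE_comp_restr W p 3]
    congr 1
    funext i
    fin_cases i
    · exact ind_eq_comp_restr_of_determinedBy W hXd
    · exact ind_eq_comp_restr_of_determinedBy W hYd
    · exact ind_eq_comp_restr_of_determinedBy W hZd

end Determined

end SahiCombJunta

end Summit.CriticalPhenomena.PercolationContinuityZ3.Theorems
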